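import Summits.AtomisticToContinuum.Crystallization.Theorems.FrustratedLawDichotomyCoherentFloorHalo
import Summits.AtomisticToContinuum.Crystallization.Theorems.FrustratedLawDichotomyPullKernel
import Literature.Barriers.AtomisticToContinuum.StickySphereClustersNarrow

/-!
# FrustratedLawDichotomy · crux `AperiodicFrustratedLawGap` (stmt-AtomisticToContinuum-27623) — «zoneFloor»: THE NASH-FREE Z-ROW FLOORS
# (ZONE-TRANSPORT, class Z of the atlas; Z floor chain of record = lens-5 ZROW-FLOOR-g114 §1 / critic r1855 (A); decomp-a2c hand-1 g55)

A class-Z root is a HOST root (its window `W = haloWindow n s R_W = closedBall 0 R_W ∩ {⟪z,n⟫ ≤ s}` is `τ`-coherent with a host template `a ∋ 0`)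
FACING uncertified matter beyond the plane.  The Z row books it WITHOUT force balance (no Nash dual, no Taylor remainders, no tables): every
analytic input is a TREE tail function.  For `S ∋ 0` `7/10`-separated, `count⌊S ∈ coherentOn a τ W`, every template ball inside `W`:

* (Z1) WINDOW, NO TAYLOR — `sum_floor_le_setIntegral_of_coherentOn`: `Σ_{x ∈ a∖0} vlo x ≤ ∫_W V_LJ d(count⌊S)` for ANY per-site floors `vlo x`
  valid on the tube `[‖x‖ − τ, ‖x‖ + τ]` (hypothesis `hvlo`; a K-file discharges it with the unimodality lemma `lennardJones_interval_floor`: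
  `V ≥ V(hi)` if `hi ≤ 1`, `≥ V(lo)` if `lo ≥ 1`, `≥ −1/12` otherwise).
* ★ BRANCH 2 `zoneFloor₂` (`s ≥ 1`, `R_W ≥ 1`): `Σ vlo − halfEnergyCol s − tailCol R_W ≤ 2·rootEnergy V_LJ (count⌊S)` — the class-H door's
  energy side (`…CoherentFloorHalo.setIntegral_ball_sdiff_lennardJones_ge`, (226) `abs_setIntegral_compl_lennardJones_le`) with the Taylor window sum replaced
  by (Z1).
* ★ BRANCH 1 `zoneFloor₁` (pull radius `1 ≤ R_Z`; abstract covariant mark `Hm` of (329) `…PullKernel` with `h0 : Hm μ 0` and the D-FACING clause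
  `hD : ∀ q ∈ S, ‖q‖ ≤ R_Z → q ∉ W → ¬ Hm μ q`):
  `Σ vlo − (tailCol R_Z − Σ_{x ∈ a∖0} kw x) ≤ 2·rootEnergy V_LJ μ + 2·(∫⁻ y, zonePull Hm R_Z μ y ∂μ).toReal`:
  (Z2) atoms in `B̄(0,R_Z) ∖ W` are unmarked, so the root pulls `zoneWeight = (−V/2)⁺` from each ((329) `pullKernel_of_mem`, `toReal_zoneWeight`) and
  `V + 2·(−V/2)⁺ ≥ 0` — they drop out; (Z3) the rest lies outside `B̄(0,R_Z)`: `≥ −(tailCol R_Z − refund)` by (226)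
  `setLIntegral_enorm_lennardJones_compl_le`, where the window's own atoms beyond `R_Z` are refunded through ANY per-site claims `kw x` that are
  positive only on far tubes (`R_Z < ‖x‖ − τ`) and then `≤ |V_LJ|` on the tube (hypothesis `hkw`; discharged by `neg_lennardJones_le_abs_of_one_le`;
  `kw := 0` is always admissible).
* `zoneFloor₁_of_isRootedHardCore` / `zoneFloor₂_of_isRootedHardCore` (abstract `μ`, D-facing clause in the plane form
  `‖q‖ ≤ R_Z → s < ⟪q,n⟫ → ¬ Hm μ q` of the Z cells, `R_Z ≤ R_W`) and the two TRANSPORTED ROW FLOORS in the shape (325)/(334) consume: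
  `floor_transport_of_zoneFloor₁` (`2(c + m) ≤ LHS₁ ⇒ c + m ≤ rootEnergy + net 0 (zonePull Hm R_Z)`, via (329) `floor_add_net_of_floor_outflow`) and
  `floor_transport_of_zoneFloor₂` (via (329) `floor_add_net_of_floor`).

UNITS: FULL on the left (`2·rootEnergy` on the right), as every door of the atlas; the adapters halve.  Boundary conventions as on the tree (r1855 (A)(i)):
`haloWindow` CLOSED, the D-facing clause STRICT (`s < ⟪q,n⟫`), complementary.  `0 < s` of the memo is implied (`τ ≤ s` from the root's ball inside `W`)
and therefore not a binder.  DEF-FREE; imports TREE `…CoherentFloorHalo` + (329) `…PullKernel` + Literature `…StickySphereClustersNarrow`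
(`strictMonoOn_lennardJones`); 0 sorry.  All `[folklore]`; nothing here closes an item.
-/

noncomputable section

namespace Summit.AtomisticToContinuum.Crystallization.Theorems.FrustratedLawDichotomyZoneFloor

open MeasureTheory Metric Set Filter RealInnerProductSpace
open scoped BigOperators Topology ENNReal
open Literature.MathematicalPhysics.StatisticalMechanics (lennardJones rootEnergy rootEnergy_def neg_one_div_le_lennardJones lennardJones_one)
open Literature.Probability.Process (IsRootedHardCore count_restrict_singleton_ne_zero_iff)
open Literature.Probability.Process.LocalConfig (finite_inter_of_separated)
open Summit.AtomisticToContinuum.Crystallization.Theorems.ChargedEnergyGapNegative (E3)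
open Summit.AtomisticToContinuum.Crystallization.Theorems.FrustratedLawDichotomySignedLedger (net)
open Summit.AtomisticToContinuum.Crystallization.Theorems.FrustratedLawDichotomyCoherentWindow
open Summit.AtomisticToContinuum.Crystallization.Theorems.FrustratedLawDichotomyCoherentOn
open Summit.AtomisticToContinuum.Crystallization.Theorems.FrustratedLawDichotomyTransportPriceTail (integrable_lennardJones_of_isRootedHardCore)
open Summit.AtomisticToContinuum.Crystallization.Theorems.FrustratedLawDichotomyCoherentFloor (tailCol setLIntegral_enorm_lennardJones_compl_le
  abs_setIntegral_compl_lennardJones_le)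
open Summit.AtomisticToContinuum.Crystallization.Theorems.FrustratedLawDichotomyCoherentFloorHalo (haloWindow halfEnergyCol measurableSet_halfSpace
  measurableSet_haloWindow closedBall_subset_haloWindow setIntegral_ball_sdiff_lennardJones_ge)
open Summit.AtomisticToContinuum.Crystallization.Theorems.FrustratedLawDichotomyPullKernel (zoneWeight zonePull pullKernel_of_mem toReal_zoneWeight
  zoneWeight_le exists_outflow_bound_zonePull floor_add_net_of_floor floor_add_net_of_floor_outflow)

/-! ## §1. Unimodality tools for the per-site literals (K-file side) -/

/-- ★ **The tube floor by unimodality.**  For `0 < lo ≤ r ≤ hi`: `V_LJ(r) ≥ V_LJ(hi)` if `hi ≤ 1` (antitone on `(0,1]`), `≥ V_LJ(lo)` if `1 ≤ lo`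
(monotone on `[1,∞)`, `Literature…strictMonoOn_lennardJones`), and `≥ −1/12` always. [folklore; BlancLewin2015 (3)] -/
theorem lennardJones_interval_floor {lo hi r : ℝ} (hlo : 0 < lo) (h1 : lo ≤ r) (h2 : r ≤ hi) :
    (if hi ≤ 1 then lennardJones hi else if 1 ≤ lo then lennardJones lo else -1 / 12) ≤ lennardJones r := by
  have hr : 0 < r := hlo.trans_le h1
  split_ifs with hhi hlo1
  · -- antitone on `(0, 1]`, in the variable `u = r⁻⁶ ≥ 1`
    have hhi0 : 0 < hi := hr.trans_le h2
    unfold lennardJones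
    set p := (r⁻¹) ^ 6 with hp
    set q := (hi⁻¹) ^ 6 with hq
    have hq1 : 1 ≤ q := by
      have h1' : (1 : ℝ) ≤ hi⁻¹ := (one_le_inv₀ hhi0).2 hhi
      calc (1 : ℝ) = 1 ^ 6 := by norm_num
        _ ≤ (hi⁻¹) ^ 6 := pow_le_pow_left₀ zero_le_one h1' 6
    have hqp : q ≤ p := pow_le_pow_left₀ (inv_nonneg.2 hhi0.le) (inv_anti₀ hr h2) 6
    have e1 : (r⁻¹) ^ 12 = p ^ 2 := by rw [hp, ← pow_mul]
    have e2 : (hi⁻¹) ^ 12 = q ^ 2 := by rw [hq, ← pow_mul]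
    rw [e1, e2]
    nlinarith [mul_nonneg (sub_nonneg.2 hqp) (by linarith : (0 : ℝ) ≤ p + q - 2)]
  · exact Literature.Barriers.AtomisticToContinuum.strictMonoOn_lennardJones.monotoneOn (Set.mem_Ici.2 hlo1)
      (Set.mem_Ici.2 (hlo1.trans h1)) h1
  · exact neg_one_div_le_lennardJones r

/-- **The tube refund.**  For `1 ≤ lo ≤ r ≤ hi`: `−V_LJ(hi) ≤ |V_LJ(r)|` (`V_LJ ≤ 0` and increasing on `[1,∞)`). [folklore] -/
theorem neg_lennardJones_le_abs_of_one_le {lo hi r : ℝ} (hlo : 1 ≤ lo) (h1 : lo ≤ r) (h2 : r ≤ hi) : -lennardJones hi ≤ |lennardJones r| := by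
  have hr : 1 ≤ r := hlo.trans h1
  have hmono := Literature.Barriers.AtomisticToContinuum.strictMonoOn_lennardJones.monotoneOn (Set.mem_Ici.2 hr)
    (Set.mem_Ici.2 (hr.trans h2)) h2
  have habs : -lennardJones r ≤ |lennardJones r| := neg_le_abs _
  linarith

/-- A point of the tube `closedBall x τ` has norm in `[‖x‖ − τ, ‖x‖ + τ]`. [folklore] -/
theorem norm_mem_tube {x q : E3} {τ : ℝ} (hq : q ∈ closedBall x τ) : ‖x‖ - τ ≤ ‖q‖ ∧ ‖q‖ ≤ ‖x‖ + τ := by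
  have h1 : ‖q - x‖ ≤ τ := by rw [← dist_eq_norm]; exact mem_closedBall.mp hq
  have h2 : ‖x‖ - ‖q‖ ≤ ‖q - x‖ := by rw [norm_sub_rev]; exact norm_sub_norm_le x q
  have h3 : ‖q‖ ≤ ‖x‖ + ‖q - x‖ := by
    calc ‖q‖ = ‖x + (q - x)‖ := by rw [add_sub_cancel]
      _ ≤ ‖x‖ + ‖q - x‖ := norm_add_le _ _
  constructor <;> linarith

/-! ## §2. (Z1) The window term without Taylor -/

variable {S : Set E3} {τ : ℝ} {a : Finset E3}

/-- ★ **(Z1) WINDOW FLOOR, NO TAYLOR.**  On a window `W` coherent with the template `a ∋ 0` (every template ball inside `W`, template points `> 2τ`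
apart), ANY per-site floors `vlo x ≤ V_LJ(r)` for `r ∈ [‖x‖ − τ, ‖x‖ + τ]` give `Σ_{x ∈ a∖0} vlo x ≤ ∫_W V_LJ(‖z‖) d(count⌊S)`
(the root is its own atom and `V_LJ(0) = 0`). [folklore] -/
theorem sum_floor_le_setIntegral_of_coherentOn {W : Set E3} (vlo : E3 → ℝ)
    (hS : ∀ p ∈ S, ∀ p' ∈ S, p ≠ p' → (7 : ℝ) / 10 ≤ dist p p') (h0S : (0 : E3) ∈ S) (hτ0 : 0 ≤ τ) (hτ : 2 * τ < 7 / 10)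
    (hW : MeasurableSet W) (hcoh : (Measure.count.restrict S : Measure E3) ∈ coherentOn a τ W) (h0a : (0 : E3) ∈ a)
    (ha : ∀ x ∈ a, ∀ x' ∈ a, x ≠ x' → 2 * τ < dist x x') (hballs : ∀ x ∈ a, closedBall x τ ⊆ W)
    (hvlo : ∀ x ∈ a.erase 0, ∀ r : ℝ, ‖x‖ - τ ≤ r → r ≤ ‖x‖ + τ → vlo x ≤ lennardJones r) :
    ∑ x ∈ a.erase 0, vlo x ≤ ∫ z in W, lennardJones ‖z‖ ∂(Measure.count.restrict S : Measure E3) := by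
  classical
  have hne : ∀ z ∈ a, (closedBall z τ ∩ S).Nonempty := fun z hz => nonempty_of_mem_coherentOn hW hcoh hz
  rw [setIntegral_eq_sum_atomOf_of_coherentOn hS hτ hW hcoh hballs ha (fun z => lennardJones ‖z‖)]
  beta_reduce
  rw [← Finset.sum_erase_add a _ h0a, atomOf_zero hS hτ h0S hτ0, norm_zero]
  have hV0 : lennardJones 0 = 0 := by unfold lennardJones; simp
  rw [hV0, add_zero]
  refine Finset.sum_le_sum fun x hx => ?_
  have hxa := Finset.mem_of_mem_erase hx
  have htube := norm_mem_tube (atomOf_mem (hne x hxa)).1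
  exact hvlo x hx _ htube.1 htube.2

/-! ## §3. ★ BRANCH 2 — the Nash-free class-H energy side -/

/-- ★ **`zoneFloor₂` — THE NASH-FREE HALO FLOOR (branch 2 of the Z row).**  `S ∋ 0` `7/10`-separated, coherent with `a ∋ 0` on the halo window
`B̄(0,R_W) ∩ {⟪z,n⟫ ≤ s}` (`‖n‖ = 1`, `s ≥ 1`, `R_W ≥ 1`, template balls inside the window), per-site tube floors `vlo`:
`Σ_{x ∈ a∖0} vlo x − halfEnergyCol s − tailCol R_W ≤ 2·rootEnergy V_LJ (count⌊S)` — window = template sum ≥ `Σ vlo` (Z1), ball beyond the plane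
`≥ −halfEnergyCol s`, outside the ball `≥ −tailCol R_W`.  No force balance is used. [folklore] -/
theorem zoneFloor₂ {Rw s : ℝ} {n : E3} (vlo : E3 → ℝ) (hn : ‖n‖ = 1) (hs : 1 ≤ s)
    (hS : ∀ p ∈ S, ∀ p' ∈ S, p ≠ p' → (7 : ℝ) / 10 ≤ dist p p') (h0S : (0 : E3) ∈ S) (hτ0 : 0 ≤ τ) (hτ : 2 * τ < 7 / 10) (hRw : 1 ≤ Rw)
    (hcoh : (Measure.count.restrict S : Measure E3) ∈ coherentOn a τ (haloWindow n s Rw)) (h0a : (0 : E3) ∈ a)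
    (ha : ∀ x ∈ a, ∀ x' ∈ a, x ≠ x' → 2 * τ < dist x x') (hin : ∀ x ∈ a, ‖x‖ + τ ≤ Rw ∧ ⟪x, n⟫ + τ ≤ s)
    (hvlo : ∀ x ∈ a.erase 0, ∀ r : ℝ, ‖x‖ - τ ≤ r → r ≤ ‖x‖ + τ → vlo x ≤ lennardJones r) :
    ∑ x ∈ a.erase 0, vlo x - halfEnergyCol s - tailCol Rw ≤ 2 * rootEnergy lennardJones (Measure.count.restrict S : Measure E3) := by
  have h7 : (0 : ℝ) < 7 / 10 := by norm_num
  have hW := measurableSet_haloWindow n s Rw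
  have hballs : ∀ z ∈ a, closedBall z τ ⊆ haloWindow n s Rw := fun z hz => closedBall_subset_haloWindow hn (hin z hz).1 (hin z hz).2
  have hwin := sum_floor_le_setIntegral_of_coherentOn vlo hS h0S hτ0 hτ hW hcoh h0a ha hballs hvlo
  have hint := integrable_lennardJones_of_isRootedHardCore h7 ⟨S, h0S, hS, rfl⟩
  have htail := (abs_le.mp (abs_setIntegral_compl_lennardJones_le hS hRw)).1
  have hhalf := setIntegral_ball_sdiff_lennardJones_ge (Rc := Rw) hn hs hS
  have hball : ∫ z in closedBall (0 : E3) Rw, lennardJones ‖z‖ ∂(Measure.count.restrict S : Measure E3) =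
      (∫ z in haloWindow n s Rw, lennardJones ‖z‖ ∂(Measure.count.restrict S : Measure E3)) +
        ∫ z in closedBall (0 : E3) Rw \ {z : E3 | ⟪z, n⟫ ≤ s}, lennardJones ‖z‖ ∂(Measure.count.restrict S : Measure E3) := by
    rw [haloWindow]
    exact (integral_inter_add_sdiff (measurableSet_halfSpace n s) hint.integrableOn).symm
  have hE : 2 * rootEnergy lennardJones (Measure.count.restrict S : Measure E3) =
      (∫ z in closedBall (0 : E3) Rw, lennardJones ‖z‖ ∂(Measure.count.restrict S : Measure E3)) +
        ∫ z in (closedBall (0 : E3) Rw)ᶜ, lennardJones ‖z‖ ∂(Measure.count.restrict S : Measure E3) := by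
    rw [rootEnergy_def, integral_add_compl measurableSet_closedBall hint]
    ring
  rw [hE, hball]
  linarith

/-! ## §4. ★ BRANCH 1 — the pull branch -/

/-- ★ **`zoneFloor₁` — THE PULL FLOOR (branch 1 of the Z row).**  `S ∋ 0` `7/10`-separated, `μ = count⌊S` coherent with `a ∋ 0` on the halo window
`W = B̄(0,R_W) ∩ {⟪z,n⟫ ≤ s}` (`‖n‖ = 1`, template balls inside `W`); pull radius `R_Z ≥ 1`; an abstract mark `Hm` with the root marked
(`h0 : Hm μ 0`) and every atom of `B̄(0,R_Z) ∖ W` unmarked (`hD`, the D-facing clause); per-site tube floors `vlo` and refunds `kw` (a positive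
refund only on tubes beyond `R_Z`, and then `≤ |V_LJ|` on the tube).  Then
`Σ_{x∈a∖0} vlo x − (tailCol R_Z − Σ_{x∈a∖0} kw x) ≤ 2·rootEnergy V_LJ μ + 2·(∫⁻ y, zonePull Hm R_Z μ y ∂μ).toReal`:
window ≥ `Σ vlo` (Z1); on `Wᶜ ∩ B̄(0,R_Z)` every atom is pulled, `V + 2·(−V/2)⁺ ≥ 0` (Z2); on `Wᶜ ∖ B̄(0,R_Z)`, `≥ −∫_{B̄ᶜ∖W}|V| =
−(∫_{B̄ᶜ}|V| − ∫_{B̄ᶜ∩W}|V|) ≥ −(tailCol R_Z − Σ kw)` (Z3).  No force balance is used. [folklore] -/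
theorem zoneFloor₁ {Rw Rz s : ℝ} {n : E3} (vlo kw : E3 → ℝ) (Hm : Measure E3 → E3 → Prop) (hn : ‖n‖ = 1)
    (hS : ∀ p ∈ S, ∀ p' ∈ S, p ≠ p' → (7 : ℝ) / 10 ≤ dist p p') (h0S : (0 : E3) ∈ S) (hτ0 : 0 ≤ τ) (hτ : 2 * τ < 7 / 10) (hRz : 1 ≤ Rz)
    (hcoh : (Measure.count.restrict S : Measure E3) ∈ coherentOn a τ (haloWindow n s Rw)) (h0a : (0 : E3) ∈ a)
    (ha : ∀ x ∈ a, ∀ x' ∈ a, x ≠ x' → 2 * τ < dist x x') (hin : ∀ x ∈ a, ‖x‖ + τ ≤ Rw ∧ ⟪x, n⟫ + τ ≤ s)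
    (hvlo : ∀ x ∈ a.erase 0, ∀ r : ℝ, ‖x‖ - τ ≤ r → r ≤ ‖x‖ + τ → vlo x ≤ lennardJones r)
    (hkw : ∀ x ∈ a.erase 0, 0 < kw x → Rz < ‖x‖ - τ ∧ ∀ r : ℝ, ‖x‖ - τ ≤ r → r ≤ ‖x‖ + τ → kw x ≤ |lennardJones r|)
    (h0 : Hm (Measure.count.restrict S : Measure E3) 0)
    (hD : ∀ q ∈ S, ‖q‖ ≤ Rz → q ∉ haloWindow n s Rw → ¬ Hm (Measure.count.restrict S : Measure E3) q) :
    ∑ x ∈ a.erase 0, vlo x - (tailCol Rz - ∑ x ∈ a.erase 0, kw x) ≤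
      2 * rootEnergy lennardJones (Measure.count.restrict S : Measure E3) +
        2 * (∫⁻ y, zonePull Hm Rz (Measure.count.restrict S : Measure E3) y ∂(Measure.count.restrict S : Measure E3)).toReal := by
  classical
  have h7 : (0 : ℝ) < 7 / 10 := by norm_num
  set μ : Measure E3 := Measure.count.restrict S with hμ
  set W : Set E3 := haloWindow n s Rw with hWdef
  set B : Set E3 := closedBall (0 : E3) Rz with hBdef
  have hW : MeasurableSet W := measurableSet_haloWindow n s Rw
  have hB : MeasurableSet B := measurableSet_closedBall
  have hne : ∀ z ∈ a, (closedBall z τ ∩ S).Nonempty := fun z hz => nonempty_of_mem_coherentOn hW hcoh hz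
  have hballs : ∀ z ∈ a, closedBall z τ ⊆ W := fun z hz => closedBall_subset_haloWindow hn (hin z hz).1 (hin z hz).2
  have hint : Integrable (fun z : E3 => lennardJones ‖z‖) μ := integrable_lennardJones_of_isRootedHardCore h7 ⟨S, h0S, hS, rfl⟩
  -- (Z1) the window
  have hwin : ∑ x ∈ a.erase 0, vlo x ≤ ∫ z in W, lennardJones ‖z‖ ∂μ :=
    sum_floor_le_setIntegral_of_coherentOn vlo hS h0S hτ0 hτ hW hcoh h0a ha hballs hvlo
  -- the energy split `E3 = W ∪ (Wᶜ ∩ B) ∪ (Wᶜ ∖ B)`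
  have hE : 2 * rootEnergy lennardJones μ = (∫ z in W, lennardJones ‖z‖ ∂μ) + ∫ z in Wᶜ, lennardJones ‖z‖ ∂μ := by
    rw [rootEnergy_def, integral_add_compl hW hint]
    ring
  have hE2 : ∫ z in Wᶜ, lennardJones ‖z‖ ∂μ = (∫ z in Wᶜ ∩ B, lennardJones ‖z‖ ∂μ) + ∫ z in Wᶜ \ B, lennardJones ‖z‖ ∂μ :=
    (integral_inter_add_sdiff hB hint.integrableOn).symm
  -- (Z2) the pulled atoms: `Wᶜ ∩ B` carries finitely many atoms, each unmarked
  have hfin : ((Wᶜ ∩ B) ∩ S).Finite :=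
    (finite_inter_of_separated h7 hS (isCompact_closedBall (0 : E3) Rz)).subset fun z hz => ⟨hz.1.2, hz.2⟩
  set F : Finset E3 := hfin.toFinset with hF
  have hmemF : ∀ z ∈ F, z ∈ S ∧ ‖z‖ ≤ Rz ∧ z ∉ W := fun z hz => by
    rw [hF, Finite.mem_toFinset] at hz
    exact ⟨hz.2, mem_closedBall_zero_iff.mp hz.1.2, hz.1.1⟩
  have hrestr : μ.restrict (Wᶜ ∩ B) = Measure.count.restrict (↑F : Set E3) := by
    rw [hμ, Measure.restrict_restrict (hW.compl.inter hB), hF, Finite.coe_toFinset]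
  have hmidE : ∫ z in Wᶜ ∩ B, lennardJones ‖z‖ ∂μ = ∑ z ∈ F, lennardJones ‖z‖ := by
    rw [hrestr, Literature.MathematicalPhysics.StatisticalMechanics.integral_count_restrict_coe_finset]
  have hpull : ∀ z ∈ F, zonePull Hm Rz μ z = zoneWeight z := fun z hz =>
    pullKernel_of_mem h0 (hmemF z hz).2.1 (hD z (hmemF z hz).1 (hmemF z hz).2.1 (hmemF z hz).2.2)
  have hmidG : ∑ z ∈ F, zoneWeight z ≤ ∫⁻ y, zonePull Hm Rz μ y ∂μ := by
    calc ∑ z ∈ F, zoneWeight z = ∑ z ∈ F, zonePull Hm Rz μ z * Measure.count {z} := by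
          refine Finset.sum_congr rfl fun z hz => ?_
          rw [hpull z hz, Measure.count_singleton, mul_one]
      _ = ∫⁻ y in Wᶜ ∩ B, zonePull Hm Rz μ y ∂μ := by rw [hrestr, lintegral_finset]
      _ ≤ ∫⁻ y, zonePull Hm Rz μ y ∂μ := setLIntegral_le_lintegral _ _
  obtain ⟨Bo, hBo, hGb⟩ := exists_outflow_bound_zonePull h7 Hm Rz
  have hfinG : ∫⁻ y, zonePull Hm Rz μ y ∂μ ≠ ∞ := ne_top_of_le_ne_top hBo (hGb μ ⟨S, h0S, hS, rfl⟩)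
  have hwne : ∀ z ∈ F, zoneWeight z ≠ ∞ := fun z _ => ne_top_of_le_ne_top ENNReal.ofReal_ne_top (zoneWeight_le z)
  have hmidG' : ∑ z ∈ F, max (-(lennardJones ‖z‖) / 2) 0 ≤ (∫⁻ y, zonePull Hm Rz μ y ∂μ).toReal := by
    have h := ENNReal.toReal_mono hfinG hmidG
    rw [ENNReal.toReal_sum hwne] at h
    simpa only [toReal_zoneWeight] using h
  have hmid : 0 ≤ (∑ z ∈ F, lennardJones ‖z‖) + 2 * ∑ z ∈ F, max (-(lennardJones ‖z‖) / 2) 0 := by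
    rw [Finset.mul_sum, ← Finset.sum_add_distrib]
    exact Finset.sum_nonneg fun z _ => by linarith [le_max_left (-(lennardJones ‖z‖) / 2) 0]
  -- (Z3) the rest lies outside `B`: tail minus the window's own far atoms
  have hset : Wᶜ \ B = Bᶜ \ W := by
    ext z
    exact ⟨fun h => ⟨h.2, h.1⟩, fun h => ⟨h.2, h.1⟩⟩
  have htailAbs : ∫ z in Bᶜ, ‖lennardJones ‖z‖‖ ∂μ ≤ tailCol Rz := by
    have h0t : 0 ≤ tailCol Rz := by
      have : 0 ≤ Rz⁻¹ := inv_nonneg.2 (by linarith)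
      unfold tailCol; positivity
    rw [integral_norm_eq_lintegral_enorm hint.aestronglyMeasurable.restrict]
    calc (∫⁻ z in Bᶜ, ‖lennardJones ‖z‖‖ₑ ∂μ).toReal ≤ (ENNReal.ofReal (tailCol Rz)).toReal :=
          ENNReal.toReal_mono ENNReal.ofReal_ne_top (setLIntegral_enorm_lennardJones_compl_le hS hRz)
      _ = tailCol Rz := ENNReal.toReal_ofReal h0t
  have hsplitAbs : (∫ z in Bᶜ ∩ W, ‖lennardJones ‖z‖‖ ∂μ) + ∫ z in Bᶜ \ W, ‖lennardJones ‖z‖‖ ∂μ =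
      ∫ z in Bᶜ, ‖lennardJones ‖z‖‖ ∂μ :=
    integral_inter_add_sdiff hW hint.norm.integrableOn
  -- the window's own atoms beyond `R_Z` refund the claims `kw`
  have hrefund : ∑ x ∈ a.erase 0, kw x ≤ ∫ z in Bᶜ ∩ W, ‖lennardJones ‖z‖‖ ∂μ := by
    have hind : ∫ z in Bᶜ ∩ W, ‖lennardJones ‖z‖‖ ∂μ = ∑ x ∈ a, (Bᶜ).indicator (fun z => ‖lennardJones ‖z‖‖) (atomOf S τ x) := by
      rw [inter_comm, ← setIntegral_indicator hB.compl,
        setIntegral_eq_sum_atomOf_of_coherentOn hS hτ hW hcoh hballs ha ((Bᶜ).indicator fun z => ‖lennardJones ‖z‖‖)]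
    rw [hind]
    have hnn : ∀ x ∈ a, 0 ≤ (Bᶜ).indicator (fun z => ‖lennardJones ‖z‖‖) (atomOf S τ x) := fun x _ =>
      Set.indicator_nonneg (fun _ _ => norm_nonneg _) _
    refine (Finset.sum_le_sum fun x hx => ?_).trans (Finset.sum_le_sum_of_subset_of_nonneg (Finset.erase_subset 0 a) fun x hx _ => hnn x hx)
    have hxa := Finset.mem_of_mem_erase hx
    by_cases hk : kw x ≤ 0
    · exact hk.trans (hnn x hxa)
    · obtain ⟨hfar, hbd⟩ := hkw x hx (not_le.mp hk)
      have htube := norm_mem_tube (atomOf_mem (hne x hxa)).1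
      have hout : atomOf S τ x ∈ Bᶜ := by
        rw [mem_compl_iff, hBdef, mem_closedBall_zero_iff, not_le]
        linarith [htube.1]
      rw [indicator_of_mem hout, Real.norm_eq_abs]
      exact hbd _ htube.1 htube.2
  have hrest : -(tailCol Rz - ∑ x ∈ a.erase 0, kw x) ≤ ∫ z in Wᶜ \ B, lennardJones ‖z‖ ∂μ := by
    rw [hset]
    have h1 : -(∫ z in Bᶜ \ W, ‖lennardJones ‖z‖‖ ∂μ) ≤ ∫ z in Bᶜ \ W, lennardJones ‖z‖ ∂μ := by
      have h := norm_integral_le_integral_norm (μ := μ.restrict (Bᶜ \ W)) (fun z : E3 => lennardJones ‖z‖)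
      rw [Real.norm_eq_abs] at h
      linarith [neg_abs_le (∫ z in Bᶜ \ W, lennardJones ‖z‖ ∂μ)]
    linarith
  -- assembly
  rw [hE, hE2, hmidE]
  linarith

/-! ## §5. Abstract configurations and the transported row floors ((325)/(334) shape) -/

/-- `zoneFloor₂` for an abstract rooted `7/10`-hard-core `μ` coherent on the halo window. [folklore] -/
theorem zoneFloor₂_of_isRootedHardCore {μ : Measure E3} {Rw s : ℝ} {n : E3} (vlo : E3 → ℝ) (hn : ‖n‖ = 1) (hs : 1 ≤ s)
    (hμ : IsRootedHardCore (7 / 10) μ) (hτ0 : 0 ≤ τ) (hτ : 2 * τ < 7 / 10) (hRw : 1 ≤ Rw) (hcoh : μ ∈ coherentOn a τ (haloWindow n s Rw))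
    (h0a : (0 : E3) ∈ a) (ha : ∀ x ∈ a, ∀ x' ∈ a, x ≠ x' → 2 * τ < dist x x') (hin : ∀ x ∈ a, ‖x‖ + τ ≤ Rw ∧ ⟪x, n⟫ + τ ≤ s)
    (hvlo : ∀ x ∈ a.erase 0, ∀ r : ℝ, ‖x‖ - τ ≤ r → r ≤ ‖x‖ + τ → vlo x ≤ lennardJones r) :
    ∑ x ∈ a.erase 0, vlo x - halfEnergyCol s - tailCol Rw ≤ 2 * rootEnergy lennardJones μ := by
  obtain ⟨S, h0S, hS, rfl⟩ := hμ
  exact zoneFloor₂ vlo hn hs hS h0S hτ0 hτ hRw hcoh h0a ha hin hvlo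

/-- `zoneFloor₁` for an abstract rooted `7/10`-hard-core `μ` coherent on the halo window, with the D-FACING clause of the Z cells in the plane
form: every atom `q` of `μ` with `‖q‖ ≤ R_Z` strictly beyond the plane (`s < ⟪q,n⟫`) is unmarked (`R_Z ≤ R_W`). [folklore] -/
theorem zoneFloor₁_of_isRootedHardCore {μ : Measure E3} {Rw Rz s : ℝ} {n : E3} (vlo kw : E3 → ℝ) (Hm : Measure E3 → E3 → Prop)
    (hn : ‖n‖ = 1) (hμ : IsRootedHardCore (7 / 10) μ) (hτ0 : 0 ≤ τ) (hτ : 2 * τ < 7 / 10) (hRz : 1 ≤ Rz) (hzw : Rz ≤ Rw)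
    (hcoh : μ ∈ coherentOn a τ (haloWindow n s Rw)) (h0a : (0 : E3) ∈ a) (ha : ∀ x ∈ a, ∀ x' ∈ a, x ≠ x' → 2 * τ < dist x x')
    (hin : ∀ x ∈ a, ‖x‖ + τ ≤ Rw ∧ ⟪x, n⟫ + τ ≤ s)
    (hvlo : ∀ x ∈ a.erase 0, ∀ r : ℝ, ‖x‖ - τ ≤ r → r ≤ ‖x‖ + τ → vlo x ≤ lennardJones r)
    (hkw : ∀ x ∈ a.erase 0, 0 < kw x → Rz < ‖x‖ - τ ∧ ∀ r : ℝ, ‖x‖ - τ ≤ r → r ≤ ‖x‖ + τ → kw x ≤ |lennardJones r|)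
    (h0 : Hm μ 0) (hD : ∀ q : E3, μ {q} ≠ 0 → ‖q‖ ≤ Rz → s < ⟪q, n⟫ → ¬ Hm μ q) :
    ∑ x ∈ a.erase 0, vlo x - (tailCol Rz - ∑ x ∈ a.erase 0, kw x) ≤ 2 * rootEnergy lennardJones μ + 2 * (∫⁻ y, zonePull Hm Rz μ y ∂μ).toReal := by
  obtain ⟨S, h0S, hS, rfl⟩ := hμ
  refine zoneFloor₁ vlo kw Hm hn hS h0S hτ0 hτ hRz hcoh h0a ha hin hvlo hkw h0 fun q hqS hqz hqW => hD q ?_ hqz ?_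
  · exact (count_restrict_singleton_ne_zero_iff S q).mpr hqS
  · by_contra hle
    exact hqW ⟨mem_closedBall_zero_iff.mpr (hqz.trans hzw), not_lt.mp hle⟩

/-- ★ **THE TRANSPORTED Z-ROW FLOOR, branch 1** (the `hfloor` line of a Z cell under (325)/(334)): with the mark's covariance `hshift` of (329), a
literal inequality `2(c + m) ≤ LHS₁` over the cell gives `c + m ≤ rootEnergy V_LJ μ + net 0 (zonePull Hm R_Z) μ`. [folklore] -/
theorem floor_transport_of_zoneFloor₁ {μ : Measure E3} {Rw Rz s c m : ℝ} {n : E3} (vlo kw : E3 → ℝ) (Hm : Measure E3 → E3 → Prop)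
    (hshift : ∀ (ν : Measure E3) (y z : E3), Hm (ν.map fun x => x - y) z ↔ Hm ν (z + y))
    (hn : ‖n‖ = 1) (hμ : IsRootedHardCore (7 / 10) μ) (hτ0 : 0 ≤ τ) (hτ : 2 * τ < 7 / 10) (hRz : 1 ≤ Rz) (hzw : Rz ≤ Rw)
    (hcoh : μ ∈ coherentOn a τ (haloWindow n s Rw)) (h0a : (0 : E3) ∈ a) (ha : ∀ x ∈ a, ∀ x' ∈ a, x ≠ x' → 2 * τ < dist x x')
    (hin : ∀ x ∈ a, ‖x‖ + τ ≤ Rw ∧ ⟪x, n⟫ + τ ≤ s)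
    (hvlo : ∀ x ∈ a.erase 0, ∀ r : ℝ, ‖x‖ - τ ≤ r → r ≤ ‖x‖ + τ → vlo x ≤ lennardJones r)
    (hkw : ∀ x ∈ a.erase 0, 0 < kw x → Rz < ‖x‖ - τ ∧ ∀ r : ℝ, ‖x‖ - τ ≤ r → r ≤ ‖x‖ + τ → kw x ≤ |lennardJones r|)
    (h0 : Hm μ 0) (hD : ∀ q : E3, μ {q} ≠ 0 → ‖q‖ ≤ Rz → s < ⟪q, n⟫ → ¬ Hm μ q)
    (hlit : 2 * (c + m) ≤ ∑ x ∈ a.erase 0, vlo x - (tailCol Rz - ∑ x ∈ a.erase 0, kw x)) :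
    c + m ≤ rootEnergy lennardJones μ + net 0 (zonePull Hm Rz) μ := by
  have h := zoneFloor₁_of_isRootedHardCore vlo kw Hm hn hμ hτ0 hτ hRz hzw hcoh h0a ha hin hvlo hkw h0 hD
  refine floor_add_net_of_floor_outflow hshift h0 ?_
  show c + m ≤ rootEnergy lennardJones μ + (∫⁻ y, zonePull Hm Rz μ y ∂μ).toReal
  linarith

/-- ★ **THE TRANSPORTED Z-ROW FLOOR, branch 2**: with the root marked (`h0`) and the mark's covariance `hshift`, a literal inequality
`2(c + m) ≤ LHS₂` gives `c + m ≤ rootEnergy V_LJ μ + net 0 (zonePull Hm R) μ` (the out-flow is simply not collected). [folklore] -/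
theorem floor_transport_of_zoneFloor₂ {μ : Measure E3} {Rw R s c m : ℝ} {n : E3} (vlo : E3 → ℝ) (Hm : Measure E3 → E3 → Prop)
    (hshift : ∀ (ν : Measure E3) (y z : E3), Hm (ν.map fun x => x - y) z ↔ Hm ν (z + y))
    (hn : ‖n‖ = 1) (hs : 1 ≤ s) (hμ : IsRootedHardCore (7 / 10) μ) (hτ0 : 0 ≤ τ) (hτ : 2 * τ < 7 / 10) (hRw : 1 ≤ Rw)
    (hcoh : μ ∈ coherentOn a τ (haloWindow n s Rw)) (h0a : (0 : E3) ∈ a) (ha : ∀ x ∈ a, ∀ x' ∈ a, x ≠ x' → 2 * τ < dist x x')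
    (hin : ∀ x ∈ a, ‖x‖ + τ ≤ Rw ∧ ⟪x, n⟫ + τ ≤ s)
    (hvlo : ∀ x ∈ a.erase 0, ∀ r : ℝ, ‖x‖ - τ ≤ r → r ≤ ‖x‖ + τ → vlo x ≤ lennardJones r) (h0 : Hm μ 0)
    (hlit : 2 * (c + m) ≤ ∑ x ∈ a.erase 0, vlo x - halfEnergyCol s - tailCol Rw) :
    c + m ≤ rootEnergy lennardJones μ + net 0 (zonePull Hm R) μ := by
  have h := zoneFloor₂_of_isRootedHardCore vlo hn hs hμ hτ0 hτ hRw hcoh h0a ha hin hvlo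
  exact floor_add_net_of_floor hshift h0 (by linarith)

end Summit.AtomisticToContinuum.Crystallization.Theorems.FrustratedLawDichotomyZoneFloor

end
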